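import Literature.AlgebraicGeometry.HodgeTheory.WeilTypeIIGenericFibreSimple
import Literature.AlgebraicGeometry.Motives.WeilDatumWeilPolarization
import Literature.NumberTheory.Automorphic.QuaternionAlgebraSplitting
import HarnessLib

/-!
# On EVERY non-split cell the quaternion algebra `D_δ` is a skew field, so the generic type-II fibre is SIMPLE (mod J1)

Family `hodge`, layer `Literature/AlgebraicGeometry/HodgeTheory`; THEOREMS ONLY (no definition, no named fact, no
`sorry`; D-0026). Sequel to `HodgeTheory/WeilTypeIIGenericFibreSimple` (first cell `(ℚ(√-3), 6, [-2])` by descent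
at `3`). Here the skew-field hypothesis `hQ` is discharged UNIFORMLY for every NON-SPLIT discriminant class: for
`K = ℚ(√-d)`, `d ≥ 1`, and `u ∈ ℚˣ` with `[u] ≠ [-1]` in `ℚˣ/Nm(Kˣ)` (`weilNormResidueGroup d`; for odd `n` the
class `[-1] = [(-1)ⁿ]` is the SPLIT cell of the vhodge route `SplitImpliesAll`, «δ ≠ [(-1)³]»), the quaternion algebra
`D_{[u]} = (-d, -u)_ℚ` is a SKEW FIELD: a non-zero non-unit would solve `X² + dY² = -u` in `ℚ` (Vignéras I §2
Cor. 2.4; tree `QuaternionAlgebra.exists_sq_sub_mul_sq_of_not_isUnit`), i.e. `-u = Nm_{K/ℚ}(X + Y√-d) ∈ Nm(Kˣ)`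
(tree `Motives.norm_algebraMap_add_mul`), i.e. `[u] = [-1]`. Consequently (with
`exists_simple_typeII_generic_fibre_of_periodConstructionAtWeilType`):

**modulo J1 alone, for EVERY odd `n`, every `d ≥ 1` and every NON-SPLIT class `[u]`, `u < 0`, Deligne's family
through any Weil-type member `(P, ψ₀, h_K)` of class `[u]` has a fibre which is a SIMPLE abelian `2n`-fold with
`End⁰ ≃ₐ[ℚ] (-d, -u)_ℚ = D_{[u]}`, carrying `ψ` with `Ψ_s ψ = -ψ Ψ_s`, `ψ² = r²(-u)·𝟙`** — in particular on every
non-split sixfold cell of the right sign (the scope of K1 `NonsplitSixfoldCells`), the director's «GENERIC SIMPLE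
type-II member» as a fibre.

* `forall_isUnit_quaternionAlgebra_of_mk_ne_mk_neg_one` — `[u] ≠ [-1] ⟹ (-d, -u)_ℚ` is a skew field;
* `exists_simple_typeII_generic_fibre_of_periodSurjective_of_nonsplit` — [U]-version;
* `exists_simple_typeII_generic_fibre_of_periodConstructionAtWeilType_of_nonsplit` — J1-version.

HONEST REMARKS. J1 / [U] is a HYPOTHESIS; nothing here proves a case of the Hodge conjecture. The converse
(`[u] = [-1] ⟹ D_{[u]} ≅ M₂(ℚ)`, the split cell, where the generic member is NOT simple but isogenous to a square
`B × B`, [Shimura1963AnalyticFamilies] §4 / van Geemen 5.11) is not formalised here.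

## References

* [VignerasLNM800] M.-F. Vignéras, *Arithmétique des algèbres de quaternions*, LNM 800 (1980), Ch. I §2 Cor. 2.4.
* [vanGeemen1994HodgeAV] B. van Geemen, LNM 1594 (1994), 4.9, 4.14, Lemma 5.2, 5.3–5.8, 5.11, proof of Thm. 6.11.
* [MumfordAV1970] D. Mumford, *Abelian Varieties* (1970), §19 Cor. 2 of Thm. 1.
* [Shimura1963AnalyticFamilies] G. Shimura, Ann. of Math. 78 (1963), §4 (Type II).
* [Deligne1982HodgeCycles] P. Deligne, LNM 900 (1982), §4, proof of Thm. 4.8.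
-/

noncomputable section

open CategoryTheory AlgebraicGeometry Module Polynomial
open scoped TensorProduct Quaternion
open Literature.AlgebraicTopology.SingularHomology
open Literature.AlgebraicGeometry Literature.AlgebraicGeometry.Motives
open Literature.AlgebraicGeometry.VanGeemen1994

namespace Literature.AlgebraicGeometry.HodgeTheory

/-! ## §1 `[u] ≠ [-1]` ⟹ `(-d, -u)_ℚ` is a skew field -/

/-- **The quaternion algebra of a NON-SPLIT cell is a skew field.** For `d ≥ 1` and `u ∈ ℚˣ` whose class in
`ℚˣ/Nm(ℚ(√-d)ˣ)` is not `[-1]`, every non-zero element of `(-d, -u)_ℚ = ℍ[ℚ, -d, -u]` is a unit: a non-zero non-unit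
gives `X² + dY² = -u` (Vignéras I §2 Cor. 2.4), i.e. `-u = Nm(X + Y√-d)`, i.e. `u⁻¹·(-1) = -u⁻¹ = Nm((X + Y√-d)⁻¹)`,
`[u] = [-1]`. [cite: VignerasLNM800, Ch. I §2 Cor. 2.4] [cite: vanGeemen1994HodgeAV, 4.9 and 4.14] -/
theorem forall_isUnit_quaternionAlgebra_of_mk_ne_mk_neg_one {d : ℕ} (hd : 0 < d) (u : ℚˣ)
    (hδ : (QuotientGroup.mk u : weilNormResidueGroup d) ≠ QuotientGroup.mk (-1)) :
    ∀ x : ℍ[ℚ,-(d : ℚ),-(u : ℚ)], x ≠ 0 → IsUnit x := by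
  intro x hx
  by_contra hxu
  haveI : Fact (Irreducible (X ^ 2 + C (d : ℚ) : ℚ[X])) := ⟨irreducible_X_sq_add_C hd⟩
  have hdQ : (0 : ℚ) < d := by exact_mod_cast hd
  obtain ⟨a, b, hab⟩ := Literature.NumberTheory.Automorphic.QuaternionAlgebra.exists_sq_sub_mul_sq_of_not_isUnit
    (neg_ne_zero.2 hdQ.ne') hx hxu
  -- `-u = a² + d b² = Nm(a + b√-d)`
  have hab' : a ^ 2 + (d : ℚ) * b ^ 2 = -(u : ℚ) := by linear_combination hab
  set k : weilField d := algebraMap ℚ (weilField d) a + algebraMap ℚ (weilField d) b * weilSqrt d with hk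
  have hnorm : Algebra.norm ℚ k = -(u : ℚ) := by
    have h := Motives.norm_algebraMap_add_mul hdQ (weilSqrt_mul_self_eq_algebraMap d)
      (exists_eq_algebraMap_add_mul_weilSqrt d) a b
    rw [hab'] at h
    convert h using 2 <;> rfl
  have hk0 : k ≠ 0 := by
    intro h0
    rw [h0, Algebra.norm_zero] at hnorm
    exact u.ne_zero (neg_eq_zero.1 hnorm.symm)
  have hmem : -u ∈ normUnitsSubgroup ℚ (weilField d) :=
    Motives.mem_normUnitsSubgroup_iff.2 ⟨Units.mk0 k hk0, by rw [Units.val_mk0, hnorm, Units.val_neg]⟩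
  apply hδ
  rw [QuotientGroup.eq]
  have e : u⁻¹ * (-1 : ℚˣ) = (-u)⁻¹ := Units.ext (by simp)
  rw [e]
  exact Subgroup.inv_mem _ hmem

/-! ## §2 The generic type-II fibre of a non-split cell is SIMPLE -/

section TypeII

variable {n d : ℕ}

/-- **A SIMPLE GENERIC TYPE-II FIBRE on every NON-SPLIT cell, [U]-version** —
`exists_simple_typeII_generic_fibre_of_periodSurjective` with the skew-field hypothesis discharged by
`forall_isUnit_quaternionAlgebra_of_mk_ne_mk_neg_one` (`[u] ≠ [-1]`). [cite: Shimura1963AnalyticFamilies, §4 (Type II)]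
[cite: MumfordAV1970, §19 Cor. 2] [cite: vanGeemen1994HodgeAV, 5.3–5.8 and proof of Thm. 6.11]
[cite: Deligne1982HodgeCycles, proof of Thm. 4.8] [cite: VignerasLNM800, Ch. I §2 Cor. 2.4] -/
theorem exists_simple_typeII_generic_fibre_of_periodSurjective_of_nonsplit (hodd : Odd n)
    {P : AbelianVariety ℂ} (hP : P.dim = 2 * n) {ψ₀ : P ⟶ P}
    (e : ProjectiveEmbedding P.X) {a : complexBetti (projectiveSpace e.n ℂ) 2}
    (ha : IsRationalClass a) (ha0 : a ≠ 0)
    (hweilP : ∃ c ∈ weilClassesOf P ψ₀ n d, c ≠ 0 ∧ IsOfHodgeType (2 * n) P.X (2 * n) n n c)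
    (u : ℚˣ) (hu : (u : ℚ) < 0) (hδ : (QuotientGroup.mk u : weilNormResidueGroup d) ≠ QuotientGroup.mk (-1))
    (hδP : HasWeilDiscriminantNondeg P ψ₀ n d
      ((d : ℂ) • complexBetti.map e.ι 2 a + complexBetti.map ψ₀.hom.hom.hom 2 (complexBetti.map e.ι 2 a))
      (QuotientGroup.mk u))
    {S : Type*} (Y : S → AbelianVariety ℂ) (Ψ : ∀ s, Y s ⟶ Y s) (hY : ∀ s, (Y s).dim = 2 * n)
    (hΨ : ∀ s, Ψ s ≫ Ψ s = -(d • 𝟙 (Y s)))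
    (hU : ∃ (m : ℕ) (hm : 1 ≤ m) (hPm : P.dim = m + 1) (hd : 0 < d) (hψ : ψ₀ ≫ ψ₀ = -(d • 𝟙 P))
        (ω : complexBetti P.X (2 + 2 * m)) (hω : IsRationalClass ω) (hω0 : ω ≠ 0),
        ∀ (J : (weilDatumOfKsymm hm hPm hd hψ e ha ha0 hω hω0).Cx →ₗ[ℂ]
            (weilDatumOfKsymm hm hPm hd hψ e ha ha0 hω hω0).Cx)
          (hW : IsWeilComplexStructure (weilDatumOfKsymm hm hPm hd hψ e ha ha0 hω hω0).hForm J),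
          ∃ (s : S) (β : bettiCohomology P.X 1 ≃ₗ[ℚ] bettiCohomology (Y s).X 1),
            (∀ x, β (bettiCohomology.map ψ₀.hom.hom.hom 1 x) = bettiCohomology.map (Ψ s).hom.hom.hom 1 (β x)) ∧
            ∀ x ∈ ((weilDatumOfKsymm hm hPm hd hψ e ha ha0 hω hω0).hodgeStructure J hW.sq).piece 1 0,
              IsOfHodgeType (2 * n) (Y s).X 1 1 0
                (Motives.ofRatClassBaseChange (ComplexPoints (Y s).X) 1 (β.toLinearMap.baseChange ℂ x))) :
    ∃ (s : S) (ψ : Y s ⟶ Y s) (c : ℕ), 0 < c ∧ Ψ s ≫ ψ = -(ψ ≫ Ψ s) ∧ ψ ≫ ψ = c • 𝟙 (Y s) ∧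
      (∃ r : ℚ, r ≠ 0 ∧ (c : ℚ) = r ^ 2 * (-(u : ℚ))) ∧
      Nonempty ((Y s).endAlgebra ≃ₐ[ℚ] ℍ[ℚ,-(d : ℚ),-(u : ℚ)]) ∧ AbelianVariety.IsSimple (Y s) := by
  obtain ⟨m, hm, hPm, hd, hrest⟩ := hU
  exact exists_simple_typeII_generic_fibre_of_periodSurjective hodd hP e ha ha0 hweilP u hu
    (forall_isUnit_quaternionAlgebra_of_mk_ne_mk_neg_one hd u hδ) hδP Y Ψ hY hΨ ⟨m, hm, hPm, hd, hrest⟩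

/-- **A SIMPLE GENERIC TYPE-II FIBRE IN DELIGNE'S FAMILY ON EVERY NON-SPLIT CELL, MODULO J1.** Granted J1: for every
odd `n`, `d ≥ 1`, and every abelian `2n`-fold `(P, ψ₀, h_K)` of Weil type `(n, n)` over `ℚ(√-d)` of non-degenerate
discriminant class `[u]`, `u < 0`, with `[u] ≠ [-1]` (a NON-SPLIT cell), Deligne's family through `P` has a fibre
which is a SIMPLE abelian variety with `End⁰ ≃ₐ[ℚ] (-d, -u)_ℚ = D_{[u]}`, carrying `ψ` with `Ψ_s ψ = -ψ Ψ_s`,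
`ψ² = r²(-u)·𝟙` — for `n = 3`: on EVERY non-split sixfold cell of the right sign, the generic simple type-II member
as a fibre, modulo J1 alone. [cite: Deligne1982HodgeCycles, §4 Prop. 4.4 and proof of Thm. 4.8]
[cite: Shimura1963AnalyticFamilies, §4 (Type II)] [cite: MumfordAV1970, §19 Cor. 2 of Thm. 1]
[cite: vanGeemen1994HodgeAV, 4.14, 5.3–5.8 and proof of Thm. 6.11] [cite: VignerasLNM800, Ch. I §2 Cor. 2.4] -/
theorem exists_simple_typeII_generic_fibre_of_periodConstructionAtWeilType_of_nonsplit
    (hJ : deligne1982_weilFamily_periodConstructionAtWeilType) (hodd : Odd n) (hd : 1 ≤ d)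
    {P : AbelianVariety ℂ} {ψ₀ : P ⟶ P} (hWT : IsWeilType P ψ₀ n d)
    (e : ProjectiveEmbedding P.X) {a : complexBetti (projectiveSpace e.n ℂ) 2}
    (ha : IsRationalClass a) (ha0 : a ≠ 0) (u : ℚˣ) (hu : (u : ℚ) < 0)
    (hδ : (QuotientGroup.mk u : weilNormResidueGroup d) ≠ QuotientGroup.mk (-1))
    (hδP : HasWeilDiscriminantNondeg P ψ₀ n d
      ((d : ℂ) • complexBetti.map e.ι 2 a + complexBetti.map ψ₀.hom.hom.hom 2 (complexBetti.map e.ι 2 a))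
      (QuotientGroup.mk u)) :
    ∃ (𝒳 S : SchemeOver ℂ) (f : 𝒳 ⟶ S) (g : 𝒳 ⟶ 𝒳) (s₀ : ComplexPoints S)
      (e' : P.X ≅ fiberOver f s₀)
      (Y : ComplexPoints S → AbelianVariety ℂ) (Ψ : ∀ s, Y s ⟶ Y s)
      (ε : ∀ s, (Y s).X ≅ fiberOver f s) (N : ℕ)
      (ι : 𝒳 ⟶ CategoryTheory.MonoidalCategoryStruct.tensorObj (projectiveSpace N ℂ) S)
      (a' : complexBetti (projectiveSpace N ℂ) 2),
      IsSmoothProjectiveFamily f (2 * n) ∧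
      AlgebraicGeometry.IsClosedImmersion ι.left ∧
      ι ≫ CategoryTheory.CartesianMonoidalCategory.snd (projectiveSpace N ℂ) S = f ∧
      IrreducibleSpace S.left ∧ AlgebraicGeometry.Smooth S.hom ∧ IsQuasiProjectiveOver S ∧
      g ≫ f = f ∧
      (e'.hom ≫ fiberι f s₀) ≫ g = ψ₀.hom.hom.hom ≫ (e'.hom ≫ fiberι f s₀) ∧
      (∀ s, (Y s).dim = 2 * n ∧ Ψ s ≫ Ψ s = -((d : ℤ) • 𝟙 (Y s)) ∧
        ((ε s).hom ≫ fiberι f s) ≫ g = (Ψ s).hom.hom.hom ≫ ((ε s).hom ≫ fiberι f s)) ∧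
      IsRationalClass a' ∧
      complexBetti.map e'.hom 2 (complexBetti.map (fiberι f s₀) 2
        (complexBetti.map
          (ι ≫ CategoryTheory.CartesianMonoidalCategory.fst (projectiveSpace N ℂ) S) 2 a')) =
        (d : ℂ) • complexBetti.map e.ι 2 a +
          complexBetti.map ψ₀.hom.hom.hom 2 (complexBetti.map e.ι 2 a) ∧
      ∃ (s : ComplexPoints S) (ψ : Y s ⟶ Y s) (c : ℕ), 0 < c ∧ Ψ s ≫ ψ = -(ψ ≫ Ψ s) ∧
        ψ ≫ ψ = c • 𝟙 (Y s) ∧ (∃ r : ℚ, r ≠ 0 ∧ (c : ℚ) = r ^ 2 * (-(u : ℚ))) ∧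
        Nonempty ((Y s).endAlgebra ≃ₐ[ℚ] ℍ[ℚ,-(d : ℚ),-(u : ℚ)]) ∧ AbelianVariety.IsSimple (Y s) := by
  have hd0 : 0 < d := hd
  exact exists_simple_typeII_generic_fibre_of_periodConstructionAtWeilType hJ hodd hd hWT e ha ha0 u hu
    (forall_isUnit_quaternionAlgebra_of_mk_ne_mk_neg_one hd0 u hδ) hδP

end TypeII

end Literature.AlgebraicGeometry.HodgeTheory

end
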